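import Summits.Langlands.Langlands.Theses.PicardMuOrdinary
import Summits.Langlands.Langlands.Theorems.PicardMuOrdinaryIrregularClassicalityResidualIrreducibility
import Literature.NumberTheory.Automorphic.AsaiSign
import Literature.NumberTheory.Automorphic.ReciprocityGLnProofs
import Literature.NumberTheory.PAdicHodge.FontaineDpst
import Literature.NumberTheory.GaloisRepresentations.PstWeilDeligne
import Literature.NumberTheory.GaloisRepresentations.ResidualGaloisRep
import Literature.NumberTheory.GaloisRepresentations.AbsIrreducibleIndexTwo
import HarnessLib

/-!
# Route `PicardMuOrdinary`, crux `IrregularClassicality` (stmt-Langlands-13758): the registered heart H dissected —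
# geometric de Rham input + trace identification + residual irreducibility + the HONEST classicality theorem

Continuation lead prover-line-stmt-Langlands-13758-c15-0, 2026-08-17; line `slope-free-polarized-limit`, skeleton
r9 → r10 (`Cruxes/IrregularClassicality/Lines/slope_free_polarized_limit.lean`).

After c14 the typed crux is closed modulo exactly two registered statements, the wall W (`stub_polarizationDebt`) and
the heart H (`stub_senClassicalityLinked`), "with no geometric input".  That is true of the COMPOSITION but not of any
PROOF of H.  H asserts automorphy of an ABSTRACT `ρ : Γ_K → GL₃(ℚ̄₃)` constrained only by (i) its geometric-Frobenius
traces off `S₀` (the twisted Picard numbers `ι⁻¹e(a_𝔭(f)ϖ_𝔭)`), (ii) unramifiedness off `S₀`, (iii) absolute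
irreducibility on quadratic subgroups, and (iv) being the `3`-adic limit of an exactly-polarized regular cuspidal
tower.  Every irregular-weight classicality mechanism, printed (Buzzard–Taylor, Pan, BCGP) or foreseeable, consumes in
addition the `λ`-ADIC HODGE THEORY of `ρ` (de Rham / Hodge–Tate weights / ordinarity at `λ`): without it
"pro-automorphic limit ⇒ classical" is FALSE (weight one for `GL₂/ℚ`: non-classical specialisations of Hida families
are `p`-adic limits of classical forms, residually irreducible, unramified a.e., and NOT de Rham).  Clauses (ii)–(iv)
carry no Hodge information at `λ`, and (i) carries it only THROUGH the identification of `ρ` with the geometric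
representation `ρ_{C,e} ⊗ ψ_e` that has those traces — i.e. through the Picard geometry again (Weil/Deligne traces,
Faltings' de Rham comparison, class field theory for `ψ`), plus Chebotarev + Brauer–Nesbitt.  So H = G + I + R + H′:

* G  (`hG`, named-fact grade, NOT in the tree): for generic `f`, `ι`, `e`, `S₀ ∋ λ`, primary `ϖ` off `S₀`, there are a
  framed `ρ_geo` and a finite `S₁ ⊇ S₀` with the twisted Picard traces and unramifiedness off `S₁`, `ρ_geo` DE RHAM at
  every `v ∣ 3` for Fontaine's pinned datum `PAdicHodge.fontainePstAdicCompletion` (the clause of the tree's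
  rendering of Pan's theorem, `Pan2022_proModularDeRhamClassical_GL2Q`).  The tree's `picardCurve_exists_lambdaAdicRep`
  gives traces/unramifiedness/irreducibility of the UNTWISTED representation and no Hodge clause.
* I  (`hI`, provable: Chebotarev `absoluteGaloisGroup.frobenius_dense` + `exists_conj_of_trace_eq` + frame-invariance
  of `IsDeRhamFramed`): de Rham-ness at `v ∣ 3` passes between two absolutely irreducible framed representations with
  the same geometric-Frobenius traces off a finite set.
* R  (`hR`, provable: the body of c14's `isAbsolutelyIrreducible_of_frobTraces`, which establishes it one line before
  its end): a `ρ` with the twisted Picard traces is RESIDUALLY absolutely irreducible.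
* H′ (`hH`, the honest heart, OPEN): a `c₀`-polarized `3`-adically pro-automorphic, de Rham at `λ`, residually
  absolutely irreducible `ρ : Γ_{ℚ(ω)} → GL₃(ℚ̄₃)` is automorphic — the `U(2,1)/ℚ(ω)`, `p = 3` RAMIFIED, all-weights
  analogue of Pan's "pro-modular + de Rham ⇒ classical"; implied by Fontaine–Mazur + reciprocity; no Picard curve in it.

`senClassicalityLinked_of_honestHeart : G → I → R → H′ → H` (H verbatim the registered signature) is the
kernel-checked bookkeeping; the four hypotheses are the stubs of skeleton r10 besides W.  Nothing here closes the item.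

References: L. Pan, Forum Math. Pi 10 (2022) e7, Thm. 6.4.7 and arXiv:2209.06366 Thm. 1.1.2; G. Boxer, F. Calegari,
T. Gee, V. Pilloni, arXiv:2502.20645 p. 3; E. Ghate, V. Vatsal, Ann. Inst. Fourier 54 (2004) (non-classical weight-one
members of Hida families); J.-M. Fontaine, B. Mazur, *Geometric Galois representations* (1995) §1; G. Faltings,
*Crystalline cohomology and p-adic Galois representations* (1989); H. Darmon, F. Diamond, R. Taylor (1995) §2.1.
-/

open Literature.NumberTheory.GaloisRepresentations Literature.NumberTheory.Automorphic
open Literature.NumberTheory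
open Literature.RepresentationTheory.Semisimple
open scoped Pointwise NumberField
open IsDedekindDomain NumberField Polynomial Filter Topology Field

-- `Summit.Langlands.Langlands.…` (summit = sub-problem name, D-0017 layout) trips `dupNamespace` on every decl.
set_option linter.dupNamespace false
set_option autoImplicit false

namespace Summit.Langlands.Langlands.Theorems.IrregularClassicality.SlopeFreePolarizedLimit

noncomputable section

/-! ### Stub R: residual absolute irreducibility from the twisted Picard traces (c14's argument, residual form) -/

/-- **Residual traces force RESIDUAL absolute irreducibility** — the residual form of c14's
`isAbsolutelyIrreducible_of_frobTraces` (same proof, stopped one line earlier).  Let `f` be a generic quartic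
(`12 ∣ #Gal(f/ℚ)`) and `ρ : Γ_K → GL₃(ℚ̄₃)` continuous with geometric-Frobenius traces `ι⁻¹ e(a_𝔭(f) ϖ_𝔭)`,
`ϖ_𝔭 ≡ 1 (mod 3)`, off a finite set.  Then an integral model `ρ₀` over `ℤ̄₃` (`exists_integralModel_of_valuationSubring`)
has reduction `θ` with open kernel (`isOpen_ker_residualRep`); by S3 (`stub_residualFrobTrace`) the residual traces of
`θ` at good geometric Frobenii are `#Fix − 1` on the four roots, i.e. (S4, `stub_augmentationCharacter`) the character
of the augmentation representation, and by density of Frobenii (`frobenius_dense`) and local constancy this holds on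
all of `Γ_K`; over an algebraic closure of the residue field the augmentation representation is irreducible
(`augmentationRep_rootSet_map_isIrreducible`), so `θ` is irreducible there by S2 (`stub_traceDetect`), hence absolutely
irreducible (Burnside), i.e. `ρ` is residually absolutely irreducible (Darmon–Diamond–Taylor §2.1). -/
theorem isResiduallyAbsIrreducible_of_frobTraces (f : ℤ[X]) (hdeg : f.natDegree = 4)
    (hsep : (f.map (Int.castRingHom ℚ)).Separable) (hgal : 12 ∣ Nat.card (f.map (Int.castRingHom ℚ)).Gal)
    (ι : PadicAlgCl 3 ≃+* ℂ) (e : (CyclotomicField 3 ℚ) →+* ℂ) (S₀ : Finset (HeightOneSpectrum (𝓞 (CyclotomicField 3 ℚ))))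
    (ϖ : HeightOneSpectrum (𝓞 (CyclotomicField 3 ℚ)) → 𝓞 (CyclotomicField 3 ℚ)) (ρ : FramedGaloisRep (CyclotomicField 3 ℚ) (PadicAlgCl 3) 3)
    (hϖ : ∀ 𝔭 ∉ S₀, ϖ 𝔭 - 1 ∈ Ideal.span {(3 : 𝓞 (CyclotomicField 3 ℚ))})
    (htr : ∀ 𝔭 ∉ S₀, ∀ 𝔓 ∈ 𝔭.primesAbove, ∀ τ : absoluteGaloisGroup (CyclotomicField 3 ℚ), IsArithFrobAt (𝓞 (CyclotomicField 3 ℚ)) τ 𝔓 →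
      FramedRep.trace ρ τ⁻¹ = ι.symm (e (↑(picardTrace f 𝔭 * ϖ 𝔭)))) :
    ρ.IsResiduallyAbsIrreducible := by
  classical
  -- (a) an integral model over `ℤ̄₃` and its reduction `θ`
  set O : ValuationSubring (PadicAlgCl 3) := padicAlgClIntegers 3 with hOdef
  have hOmem : ∀ x : PadicAlgCl 3, x ∈ O ↔ ‖x‖ ≤ 1 := padicAlgCl_mem_valuationSubring_iff 3
  have hOopen : IsOpen (O : Set (PadicAlgCl 3)) := Valued.isOpen_valuationSubring _
  obtain ⟨Pm, ρ₀, hP⟩ := exists_integralModel_of_valuationSubring (O := O) hOopen ρ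
  set κ : Type := IsLocalRing.ResidueField O with hκ
  set θ : absoluteGaloisGroup (CyclotomicField 3 ℚ) →* GL (Fin 3) κ :=
    (Matrix.GeneralLinearGroup.map (IsLocalRing.residue O)).comp ρ₀ with hθdef
  have hθcoe : ∀ g, ((θ g : GL (Fin 3) κ) : Matrix (Fin 3) (Fin 3) κ) =
      ((ρ₀ g : GL (Fin 3) O) : Matrix (Fin 3) (Fin 3) O).map (IsLocalRing.residue O) := fun g => rfl
  have hker : IsOpen (θ.ker : Set (absoluteGaloisGroup (CyclotomicField 3 ℚ))) := by
    refine isOpen_ker_residualRep ?_ hP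
    have heq : {x : PadicAlgCl 3 | ∃ h : x ∈ O, (⟨x, h⟩ : O) ∈ IsLocalRing.maximalIdeal O} = {x | ‖x‖ < 1} := by
      ext x
      simp only [Set.mem_setOf_eq]
      constructor
      · rintro ⟨h, hx⟩
        exact (mem_maximalIdeal_iff_norm_lt_one hOmem ⟨x, h⟩).1 hx
      · intro hx
        exact ⟨(hOmem x).2 hx.le, (mem_maximalIdeal_iff_norm_lt_one hOmem _).2 hx⟩
    rw [heq]
    exact isOpen_lt continuous_norm continuous_const
  -- (b) traces of the integral model
  have htr0 : ∀ g, ((((ρ₀ g : GL (Fin 3) O) : Matrix (Fin 3) (Fin 3) O).trace : O) : PadicAlgCl 3) =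
      FramedRep.trace ρ g := by
    intro g
    have h1 : (((ρ₀ g : GL (Fin 3) O) : Matrix (Fin 3) (Fin 3) O).map O.subtype) =
        ((Matrix.GeneralLinearGroup.map O.subtype (ρ₀ g) : GL (Fin 3) (PadicAlgCl 3)) :
          Matrix (Fin 3) (Fin 3) (PadicAlgCl 3)) := rfl
    have h2 := trace_map_ringHom O.subtype ((ρ₀ g : GL (Fin 3) O) : Matrix (Fin 3) (Fin 3) O)
    rw [h1, hP g, Units.val_mul, Units.val_mul, Matrix.trace_units_conj'] at h2
    exact h2.symm
  -- (c) the residual trace at good geometric Frobenii (S3)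
  haveI : IsCyclotomicExtension {3} ℚ (CyclotomicField 3 ℚ) := CyclotomicField.isCyclotomicExtension 3 ℚ
  have hcardX : Fintype.card ((f.map (algebraMap ℤ (CyclotomicField 3 ℚ))).rootSet (AlgebraicClosure (CyclotomicField 3 ℚ))) = 4 :=
    card_rootSet_map_algebraMap_int (CyclotomicField 3 ℚ) hdeg hsep
  have hπ0 := fun {k : Type} [Field k] (h2 : (2 : k) ≠ 0) =>
    augmentationRep_rootSet_map_isIrreducible (K := (CyclotomicField 3 ℚ)) f hdeg hsep hgal h2
  set X := ((f.map (algebraMap ℤ (CyclotomicField 3 ℚ))).rootSet (AlgebraicClosure (CyclotomicField 3 ℚ))) with hXdef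
  set Bad : Set (HeightOneSpectrum (𝓞 (CyclotomicField 3 ℚ))) := {v | ¬ ((3 : 𝓞 (CyclotomicField 3 ℚ)) ∉ v.asIdeal ∧
      (f.map ((Ideal.Quotient.mk v.asIdeal).comp (algebraMap ℤ (𝓞 (CyclotomicField 3 ℚ))))).natDegree = 4 ∧
      (f.map ((Ideal.Quotient.mk v.asIdeal).comp (algebraMap ℤ (𝓞 (CyclotomicField 3 ℚ))))).Separable)} with hBad
  have hBadfin : Bad.Finite := picard_setOf_badPlace_finite f hdeg hsep
  set S' : Set (HeightOneSpectrum (𝓞 (CyclotomicField 3 ℚ))) := (S₀ : Set (HeightOneSpectrum (𝓞 (CyclotomicField 3 ℚ)))) ∪ Bad with hS'def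
  have hS' : S'.Finite := S₀.finite_toSet.union hBadfin
  set D : Set (absoluteGaloisGroup (CyclotomicField 3 ℚ)) :=
    {g | ∃ v ∉ S', ∃ 𝔓 ∈ v.primesAbove, IsArithFrobAt (𝓞 (CyclotomicField 3 ℚ)) g⁻¹ 𝔓} with hDdef
  have hD : Dense D := by
    have h := absoluteGaloisGroup.frobenius_dense chebotarev_artinRep_holds (CyclotomicField 3 ℚ) S' hS'
    exact h.preimage (Homeomorph.inv (absoluteGaloisGroup (CyclotomicField 3 ℚ))).isOpenMap
  have hresD : ∀ g ∈ D, IsLocalRing.residue O (((ρ₀ g : GL (Fin 3) O) : Matrix (Fin 3) (Fin 3) O).trace) =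
      (Nat.card {x : X // g • x = x} : κ) - 1 := by
    rintro g ⟨v, hv, 𝔓, h𝔓, hg⟩
    have hvS₀ : v ∉ S₀ := fun h => hv (Or.inl h)
    have hgood : (3 : 𝓞 (CyclotomicField 3 ℚ)) ∉ v.asIdeal ∧
        (f.map ((Ideal.Quotient.mk v.asIdeal).comp (algebraMap ℤ (𝓞 (CyclotomicField 3 ℚ))))).natDegree = 4 ∧
        (f.map ((Ideal.Quotient.mk v.asIdeal).comp (algebraMap ℤ (𝓞 (CyclotomicField 3 ℚ))))).Separable := by
      by_contra h
      exact hv (Or.inr h)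
    obtain ⟨hx, hresx⟩ := stub_residualFrobTrace f hdeg hsep ι e (ϖ v) (hϖ v hvS₀) v hgood.1 hgood.2.1
      hgood.2.2 𝔓 h𝔓 g⁻¹ hg
    have heq : (⟨ι.symm (e (↑(picardTrace f v * ϖ v))), hx⟩ : O) =
        ((ρ₀ g : GL (Fin 3) O) : Matrix (Fin 3) (Fin 3) O).trace := by
      apply Subtype.ext
      rw [htr0 g]
      have h := htr v hvS₀ 𝔓 h𝔓 g⁻¹ hg
      rw [inv_inv] at h
      exact h.symm
    rw [← heq, hresx, natCard_fixed_inv]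
  -- (d) … hence everywhere, by local constancy and density
  set ER : IntermediateField (CyclotomicField 3 ℚ) (AlgebraicClosure (CyclotomicField 3 ℚ)) :=
    IntermediateField.adjoin (CyclotomicField 3 ℚ) (X : Set (AlgebraicClosure (CyclotomicField 3 ℚ))) with hER
  haveI : FiniteDimensional (CyclotomicField 3 ℚ) ER :=
    IntermediateField.finiteDimensional_adjoin fun x _ => Algebra.IsIntegral.isIntegral x
  set H : Subgroup (absoluteGaloisGroup (CyclotomicField 3 ℚ)) :=
    (ER.fixingSubgroup).comap (absoluteGaloisGroup.toAlgEquiv (CyclotomicField 3 ℚ)).toMonoidHom with hHdef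
  have hHopen : IsOpen (H : Set (absoluteGaloisGroup (CyclotomicField 3 ℚ))) := ER.fixingSubgroup_isOpen
  have hHfix : ∀ h ∈ H, ∀ x : X, h • x = x := by
    intro h hh x
    apply Subtype.ext
    rw [rootSet.coe_smul, absoluteGaloisGroup.smul_def]
    exact (IntermediateField.mem_fixingSubgroup_iff _ _).1 hh _ (IntermediateField.subset_adjoin (CyclotomicField 3 ℚ) _ x.2)
  have hres : ∀ g, IsLocalRing.residue O (((ρ₀ g : GL (Fin 3) O) : Matrix (Fin 3) (Fin 3) O).trace) =
      (Nat.card {x : X // g • x = x} : κ) - 1 := by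
    intro g₀
    set U : Set (absoluteGaloisGroup (CyclotomicField 3 ℚ)) := (fun g => g₀⁻¹ * g) ⁻¹' ((H : Set _) ∩ (θ.ker : Set _)) with hU
    have hUopen : IsOpen U := (hHopen.inter hker).preimage (continuous_const_mul g₀⁻¹)
    have hg₀U : g₀ ∈ U := by
      show g₀⁻¹ * g₀ ∈ (H : Set _) ∩ (θ.ker : Set _)
      rw [inv_mul_cancel]
      exact ⟨H.one_mem, θ.ker.one_mem⟩
    obtain ⟨g, hgU, hgD⟩ := hD.inter_open_nonempty U hUopen ⟨g₀, hg₀U⟩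
    obtain ⟨hgH, hgker⟩ := hgU
    have hgg : g = g₀ * (g₀⁻¹ * g) := by group
    -- same residual matrix
    have hθeq : θ g = θ g₀ := by
      rw [hgg, map_mul, (MonoidHom.mem_ker).1 hgker, mul_one]
    -- same action on the roots
    have hsmul : ∀ x : X, g • x = g₀ • x := fun x => by
      rw [hgg, mul_smul, hHfix _ hgH x]
    have hcard : Nat.card {x : X // g • x = x} = Nat.card {x : X // g₀ • x = x} :=
      Nat.card_congr (Equiv.subtypeEquivRight fun x => by rw [hsmul x])
    have htrθ : ∀ h, IsLocalRing.residue O (((ρ₀ h : GL (Fin 3) O) : Matrix (Fin 3) (Fin 3) O).trace) =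
        ((θ h : GL (Fin 3) κ) : Matrix (Fin 3) (Fin 3) κ).trace := fun h => by
      rw [hθcoe, trace_map_ringHom]
    rw [htrθ, ← hθeq, ← htrθ, hresD g hgD, hcard]
  -- (e) the comparison over an algebraic closure of the residue field
  set K' : Type := AlgebraicClosure κ with hK'
  haveI : CharP κ 3 := PadicAlgCl.charP_residueField 3
  haveI : CharP K' 3 := charP_of_injective_algebraMap (algebraMap κ K').injective 3
  have h2 : (2 : K') ≠ 0 := by
    intro h
    have h' : ((2 : ℕ) : K') = 0 := by exact_mod_cast h
    rw [CharP.cast_eq_zero_iff K' 3] at h'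
    omega
  let fK : κ →+* K' := algebraMap κ K'
  set θ' : absoluteGaloisGroup (CyclotomicField 3 ℚ) →* GL (Fin 3) K' := (Matrix.GeneralLinearGroup.map fK).comp θ with hθ'def
  haveI : Nonempty X := by
    rw [← Fintype.card_pos_iff, hcardX]
    norm_num
  have hπ := hπ0 h2
  have hdim : Module.finrank K' (Fin 3 → K') = Module.finrank K' (augmentationSubmodule K' X) := by
    rw [Module.finrank_fin_fun, finrank_augmentationSubmodule, Nat.card_eq_fintype_card, hcardX]
  have htrace : ∀ g : absoluteGaloisGroup (CyclotomicField 3 ℚ),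
      LinearMap.trace K' (Fin 3 → K') (glRepresentation θ' g) =
        LinearMap.trace K' (augmentationSubmodule K' X) (augmentationRep K' (absoluteGaloisGroup (CyclotomicField 3 ℚ)) X g) := by
    intro g
    rw [stub_augmentationCharacter K' (absoluteGaloisGroup (CyclotomicField 3 ℚ)) X g]
    have e1 : (glRepresentation θ' g : (Fin 3 → K') →ₗ[K'] (Fin 3 → K')) =
        Matrix.toLin' ((θ' g : GL (Fin 3) K') : Matrix (Fin 3) (Fin 3) K') :=
      LinearMap.ext fun w => rfl
    have e2 : ((θ' g : GL (Fin 3) K') : Matrix (Fin 3) (Fin 3) K') =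
        ((θ g : GL (Fin 3) κ) : Matrix (Fin 3) (Fin 3) κ).map fK := rfl
    rw [e1, Matrix.trace_toLin'_eq, e2, trace_map_ringHom, hθcoe, trace_map_ringHom, hres g,
      map_sub, map_natCast, map_one]
  have hσ : (glRepresentation θ').IsIrreducible :=
    stub_traceDetect K' (absoluteGaloisGroup (CyclotomicField 3 ℚ)) (augmentationSubmodule K' X) (Fin 3 → K')
      (augmentationRep K' (absoluteGaloisGroup (CyclotomicField 3 ℚ)) X) (glRepresentation θ') hπ hdim htrace
  -- (f) Burnside: `θ` is absolutely irreducible, so `ρ` is residually absolutely irreducible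
  have hspan' := span_eq_top_of_isIrreducible (hirr := hσ) θ'
  simp_rw [hθ'def, coe_map_comp_apply] at hspan'
  have hspan := (span_range_map_eq_top_iff fK _).1 hspan'
  have habs : IsAbsIrreducible θ := (span_eq_top_iff_forall_isIrreducible (by norm_num) θ).1 hspan
  refine ⟨θ, ⟨ρ₀, 1, ⟨Pm, fun g => hP g⟩, fun g => ?_⟩, habs⟩
  rw [one_mul, inv_one, mul_one]
  rfl

/-- **Registered stub R `stub_residualAbsIrreducibility` of skeleton r10** — the closed form of
`isResiduallyAbsIrreducible_of_frobTraces`. -/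
theorem stub_residualAbsIrreducibility :
∀ (f : ℤ[X]), f.natDegree = 4 → (f.map (Int.castRingHom ℚ)).Separable →
    12 ∣ Nat.card (f.map (Int.castRingHom ℚ)).Gal →
  ∀ (ι : PadicAlgCl 3 ≃+* ℂ) (e : (CyclotomicField 3 ℚ) →+* ℂ) (S₀ : Finset (HeightOneSpectrum (𝓞 (CyclotomicField 3 ℚ))))
    (ϖ : HeightOneSpectrum (𝓞 (CyclotomicField 3 ℚ)) → 𝓞 (CyclotomicField 3 ℚ)) (ρ : FramedGaloisRep (CyclotomicField 3 ℚ) (PadicAlgCl 3) 3),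
    (∀ 𝔭 ∉ S₀, ϖ 𝔭 - 1 ∈ Ideal.span {(3 : 𝓞 (CyclotomicField 3 ℚ))}) →
    (∀ 𝔭 ∉ S₀, ∀ 𝔓 ∈ 𝔭.primesAbove, ∀ τ : absoluteGaloisGroup (CyclotomicField 3 ℚ), IsArithFrobAt (𝓞 (CyclotomicField 3 ℚ)) τ 𝔓 →
      FramedRep.trace ρ τ⁻¹ = ι.symm (e (↑(picardTrace f 𝔭 * ϖ 𝔭)))) →
    ρ.IsResiduallyAbsIrreducible :=
  fun f hdeg hsep hgal ι e S₀ ϖ ρ hϖ htr => isResiduallyAbsIrreducible_of_frobTraces f hdeg hsep hgal ι e S₀ ϖ ρ hϖ htr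

/-! ### The former heart H from G, I, R, H′ -/

/-- **The registered heart H of line `slope-free-polarized-limit` from the four honest statements G, I, R, H′**
(see the module docstring; the four binders are, verbatim, the stubs `stub_geometricDeRhamInput`,
`stub_traceIdentification`, `stub_residualAbsIrreducibility`, `stub_honestHeart` of skeleton r10, and the conclusion is,
verbatim, the registered `stub_senClassicalityLinked`).  Proof: G gives the geometric de Rham `ρ_geo` with the same
twisted traces off `S₁ ⊇ S₀`; `ρ_geo` is absolutely irreducible by c14's `stub_residualIrreducibility` and `ρ` is
residually absolutely irreducible by R, hence absolutely irreducible (Darmon–Diamond–Taylor §2.1,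
`IsResiduallyAbsIrreducible.isAbsolutelyIrreducible`); I transfers de Rham-ness to `ρ`; H′ at `S := S_K`, whose tower
clause is H's rewritten through the witness traces (`ι⁻¹(N𝔭·Σα) − tr ρ(Frob_𝔭⁻¹) = ι⁻¹ t`), concludes. -/
theorem senClassicalityLinked_of_honestHeart :
    (∀ (f : ℤ[X]), f.natDegree = 4 → (f.map (Int.castRingHom ℚ)).Separable → 12 ∣ Nat.card (f.map (Int.castRingHom ℚ)).Gal → ∀ (ι : PadicAlgCl 3 ≃+* ℂ) (e : (CyclotomicField 3 ℚ) →+* ℂ) (S₀ : Finset (HeightOneSpectrum (𝓞 (CyclotomicField 3 ℚ)))) (ϖ : HeightOneSpectrum (𝓞 (CyclotomicField 3 ℚ)) → 𝓞 (CyclotomicField 3 ℚ)), (∀ v : HeightOneSpectrum (𝓞 (CyclotomicField 3 ℚ)), ((3 : ℕ) : 𝓞 (CyclotomicField 3 ℚ)) ∈ v.asIdeal → v ∈ S₀) → (∀ 𝔭 ∉ S₀, 𝔭.asIdeal = Ideal.span {ϖ 𝔭} ∧ ϖ 𝔭 - 1 ∈ Ideal.span {(3 : 𝓞 (CyclotomicField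 3 ℚ))}) → ∃ (ρ : FramedGaloisRep (CyclotomicField 3 ℚ) (PadicAlgCl 3) 3) (S₁ : Finset (HeightOneSpectrum (𝓞 (CyclotomicField 3 ℚ)))), S₀ ⊆ S₁ ∧ (∀ 𝔭 ∉ S₁, ρ.IsUnramifiedAt 𝔭 ∧ ∀ 𝔓 ∈ 𝔭.primesAbove, ∀ τ : absoluteGaloisGroup (CyclotomicField 3 ℚ), IsArithFrobAt (𝓞 (CyclotomicField 3 ℚ)) τ 𝔓 → FramedRep.trace ρ τ⁻¹ = ι.symm (e (↑(picardTrace f 𝔭 * ϖ 𝔭)))) ∧ (∀ (v : HeightOneSpectrum (𝓞 (CyclotomicField 3 ℚ))) (hv : ((3 : ℕ) : 𝓞 (CyclotomicField 3 ℚ)) ∈ v.asIdeal), (PAdicHodge.fontainePstAdicCompletion v 3 hv).IsDeRhamFramed (ρ.toLocal v))) → (∀ (S : Finset (HeightOneSpectrum (𝓞 (CyclotomicField 3 ℚ)))) (ρ ρ' : FramedGaloisRep (CyclotomicField 3 ℚ) (PadicAlgCl 3) 3), FramedRep.IsAbsolutelyIrreducible ρ → FramedRep.IsAbsolutelyIrreducible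 ρ' → (∀ 𝔭 ∉ S, ∀ 𝔓 ∈ 𝔭.primesAbove, ∀ τ : absoluteGaloisGroup (CyclotomicField 3 ℚ), IsArithFrobAt (𝓞 (CyclotomicField 3 ℚ)) τ 𝔓 → FramedRep.trace ρ τ⁻¹ = FramedRep.trace ρ' τ⁻¹) → (∀ (v : HeightOneSpectrum (𝓞 (CyclotomicField 3 ℚ))) (hv : ((3 : ℕ) : 𝓞 (CyclotomicField 3 ℚ)) ∈ v.asIdeal), (PAdicHodge.fontainePstAdicCompletion v 3 hv).IsDeRhamFramed (ρ'.toLocal v)) → ∀ (v : HeightOneSpectrum (𝓞 (CyclotomicField 3 ℚ))) (hv : ((3 : ℕ) : 𝓞 (CyclotomicField 3 ℚ)) ∈ v.asIdeal), (PAdicHodge.fontainePstAdicCompletion v 3 hv).IsDeRhamFramed (ρ.toLocal v)) → (∀ (f : ℤ[X]), f.natDegree = 4 → (f.map (Int.castRingHom ℚ)).Separable → 12 ∣ Nat.card (f.map (Int.castRingHom ℚ)).Gal → ∀ (ι : PadicAlgCl 3 ≃+* ℂ) (e : (CyclotomicField 3 ℚ) →+* ℂ) (S₀ : Finset (HeightOneSpectrum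 (𝓞 (CyclotomicField 3 ℚ)))) (ϖ : HeightOneSpectrum (𝓞 (CyclotomicField 3 ℚ)) → 𝓞 (CyclotomicField 3 ℚ)) (ρ : FramedGaloisRep (CyclotomicField 3 ℚ) (PadicAlgCl 3) 3), (∀ 𝔭 ∉ S₀, ϖ 𝔭 - 1 ∈ Ideal.span {(3 : 𝓞 (CyclotomicField 3 ℚ))}) → (∀ 𝔭 ∉ S₀, ∀ 𝔓 ∈ 𝔭.primesAbove, ∀ τ : absoluteGaloisGroup (CyclotomicField 3 ℚ), IsArithFrobAt (𝓞 (CyclotomicField 3 ℚ)) τ 𝔓 → FramedRep.trace ρ τ⁻¹ = ι.symm (e (↑(picardTrace f 𝔭 * ϖ 𝔭)))) → ρ.IsResiduallyAbsIrreducible) → (∀ (hcpt : isCompact_glFiniteIntegralLevel 3 (CyclotomicField 3 ℚ)) (ι : PadicAlgCl 3 ≃+* ℂ) (c₀ : (CyclotomicField 3 ℚ) ≃ₐ[ℚ] (CyclotomicField 3 ℚ)) (S : Finset (HeightOneSpectrum (𝓞 (CyclotomicField 3 ℚ)))) (ρ : FramedGaloisRep (CyclotomicField 3 ℚ) (PadicAlgCl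 3) 3), c₀ ≠ 1 → (∀ v : HeightOneSpectrum (𝓞 (CyclotomicField 3 ℚ)), ((3 : ℕ) : 𝓞 (CyclotomicField 3 ℚ)) ∈ v.asIdeal → v ∈ S) → ρ.IsResiduallyAbsIrreducible → (∀ (v : HeightOneSpectrum (𝓞 (CyclotomicField 3 ℚ))) (hv : ((3 : ℕ) : 𝓞 (CyclotomicField 3 ℚ)) ∈ v.asIdeal), (PAdicHodge.fontainePstAdicCompletion v 3 hv).IsDeRhamFramed (ρ.toLocal v)) → (∀ 𝔭 ∉ S, ρ.IsUnramifiedAt 𝔭) → (∀ k : ℕ, ∃ (P : CuspidalAutomorphicRepData 3 (CyclotomicField 3 ℚ) hcpt) (r : FramedGaloisRep (CyclotomicField 3 ℚ) (PadicAlgCl 3) 3), P.1.IsRegularAlgebraic ∧ P.1.IsConjSelfDualAE c₀ ∧ ∀ 𝔭 ∉ S, P.1.IsUnramifiedAt 𝔭 ∧ IsGaloisCompatibleAt P.1 ι r 𝔭 ∧ ∃ α : Multiset ℂ, P.1.HasSatakeParamAt 𝔭 α ∧ ∀ 𝔓 ∈ 𝔭.primesAbove, ∀ τ : absoluteGaloisGroup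 (CyclotomicField 3 ℚ), IsArithFrobAt (𝓞 (CyclotomicField 3 ℚ)) τ 𝔓 → ‖ι.symm ((𝔭.residueCard : ℂ) * α.sum) - FramedRep.trace ρ τ⁻¹‖ ≤ ((3 : ℝ)⁻¹) ^ k) → ∃ (π' : CuspidalAutomorphicRepData 3 (CyclotomicField 3 ℚ) hcpt) (S' : Finset (HeightOneSpectrum (𝓞 (CyclotomicField 3 ℚ)))), π'.1.IsLAlgebraic ∧ ∀ 𝔭 ∉ S', ∃ α : Multiset ℂ, π'.1.HasSatakeParamAt 𝔭 α ∧ ρ.IsUnramifiedAt 𝔭 ∧ ρ.HasFrobCharpolyAt 𝔭 (arithFrobPolyOfSatake ι 𝔭.residueCard 1 α)) → ∀ (f : Polynomial ℤ) (hcpt : isCompact_glFiniteIntegralLevel 3 (CyclotomicField 3 ℚ)), f.natDegree = 4 → (f.map (Int.castRingHom ℚ)).Separable → 12 ∣ Nat.card (f.map (Int.castRingHom ℚ)).Gal → ∀ (ι : PadicAlgCl 3 ≃+* ℂ) (e : CyclotomicField 3 ℚ →+* ℂ) (S₀ : Finset (HeightOneSpectrum (𝓞 (CyclotomicField 3 ℚ))))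 (ϖ : HeightOneSpectrum (𝓞 (CyclotomicField 3 ℚ)) → 𝓞 (CyclotomicField 3 ℚ)) (ρ : FramedGaloisRep (CyclotomicField 3 ℚ) (PadicAlgCl 3) 3), (∀ v : HeightOneSpectrum (𝓞 (CyclotomicField 3 ℚ)), ((3 : ℕ) : 𝓞 (CyclotomicField 3 ℚ)) ∈ v.asIdeal → v ∈ S₀) → (∀ 𝔭 ∉ S₀, (𝔭.asIdeal = Ideal.span {ϖ 𝔭} ∧ ϖ 𝔭 - 1 ∈ Ideal.span {(3 : 𝓞 (CyclotomicField 3 ℚ))}) ∧ ρ.IsUnramifiedAt 𝔭 ∧ ∀ 𝔓 ∈ 𝔭.primesAbove, ∀ τ : Field.absoluteGaloisGroup (CyclotomicField 3 ℚ), IsArithFrobAt (𝓞 (CyclotomicField 3 ℚ)) τ 𝔓 → FramedRep.trace ρ τ⁻¹ = ι.symm (e (↑(picardTrace f 𝔭 * ϖ 𝔭)))) → (∀ (L : Type) [Field L] [NumberField L] [Algebra (CyclotomicField 3 ℚ) L], Module.finrank (CyclotomicField 3 ℚ) L = 2 → FramedRep.IsAbsolutelyIrreducible (ρ.restrictField L))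 → ∀ (c₀ : CyclotomicField 3 ℚ ≃ₐ[ℚ] CyclotomicField 3 ℚ) (S_K : Finset (HeightOneSpectrum (𝓞 (CyclotomicField 3 ℚ)))), c₀ ≠ 1 → S₀ ⊆ S_K → (∀ k : ℕ, ∃ (P : CuspidalAutomorphicRepData 3 (CyclotomicField 3 ℚ) hcpt) (r : FramedGaloisRep (CyclotomicField 3 ℚ) (PadicAlgCl 3) 3), P.1.IsRegularAlgebraic ∧ P.1.IsConjSelfDualAE c₀ ∧ ∀ 𝔭 ∉ S_K, P.1.IsUnramifiedAt 𝔭 ∧ IsGaloisCompatibleAt P.1 ι r 𝔭 ∧ ∃ (α : Multiset ℂ) (t : integralClosure ℤ ℂ), P.1.HasSatakeParamAt 𝔭 α ∧ (t : ℂ) = (𝔭.residueCard : ℂ) * α.sum - e (↑(picardTrace f 𝔭 * ϖ 𝔭)) ∧ ‖ι.symm (t : ℂ)‖ ≤ ((3 : ℝ)⁻¹) ^ k) → ∃ (π' : CuspidalAutomorphicRepData 3 (CyclotomicField 3 ℚ) hcpt) (S' : Finset (HeightOneSpectrum (𝓞 (CyclotomicField 3 ℚ)))), π'.1.IsLAlgebraic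 ∧ ∀ 𝔭 ∉ S', ∃ α : Multiset ℂ, π'.1.HasSatakeParamAt 𝔭 α ∧ ρ.IsUnramifiedAt 𝔭 ∧ ρ.HasFrobCharpolyAt 𝔭 (arithFrobPolyOfSatake ι 𝔭.residueCard 1 α) := by
  intro hG hI hR hH f hcpt hdeg hsep hgal ι e S₀ ϖ ρ hlam hwit _hirrL c₀ S_K hc₀ hS htower
  -- G: the geometric representation with the same twisted traces off `S₁ ⊇ S₀`, de Rham at `λ`.
  obtain ⟨ρ', S₁, hS₁, hgeo, hdR'⟩ := hG f hdeg hsep hgal ι e S₀ ϖ hlam (fun 𝔭 h𝔭 => (hwit 𝔭 h𝔭).1)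
  -- R: `ρ` is residually absolutely irreducible, hence absolutely irreducible (Darmon–Diamond–Taylor §2.1).
  have hres : ρ.IsResiduallyAbsIrreducible :=
    hR f hdeg hsep hgal ι e S₀ ϖ ρ (fun 𝔭 h𝔭 => (hwit 𝔭 h𝔭).1.2) (fun 𝔭 h𝔭 => (hwit 𝔭 h𝔭).2.2)
  have habs : FramedRep.IsAbsolutelyIrreducible ρ :=
    FramedGaloisRep.IsResiduallyAbsIrreducible.isAbsolutelyIrreducible (by norm_num) hres
  -- c14's S2–S4: `ρ_geo` is absolutely irreducible from its traces off `S₁`.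
  have habs' : FramedRep.IsAbsolutelyIrreducible ρ' :=
    stub_residualIrreducibility f hdeg hsep hgal ι e S₁ ϖ ρ'
      (fun 𝔭 h𝔭 => (hwit 𝔭 (fun h => h𝔭 (hS₁ h))).1.2) (fun 𝔭 h𝔭 => (hgeo 𝔭 h𝔭).2)
  -- I: transfer de Rham-ness to `ρ` along the equal traces off `S₁`.
  have hdR : ∀ (v : HeightOneSpectrum (𝓞 (CyclotomicField 3 ℚ))) (hv : ((3 : ℕ) : 𝓞 (CyclotomicField 3 ℚ)) ∈ v.asIdeal),
      (PAdicHodge.fontainePstAdicCompletion v 3 hv).IsDeRhamFramed (ρ.toLocal v) := by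
    refine hI S₁ ρ ρ' habs habs' (fun 𝔭 h𝔭 𝔓 h𝔓 τ hτ => ?_) hdR'
    rw [(hwit 𝔭 (fun h => h𝔭 (hS₁ h))).2.2 𝔓 h𝔓 τ hτ, (hgeo 𝔭 h𝔭).2 𝔓 h𝔓 τ hτ]
  -- H′ at `S := S_K`, with the tower clause rewritten through the witness traces.
  refine hH hcpt ι c₀ S_K ρ hc₀ (fun v hv => hS (hlam v hv)) hres hdR
    (fun 𝔭 h𝔭 => (hwit 𝔭 (fun h => h𝔭 (hS h))).2.1) (fun k => ?_)
  obtain ⟨P, r, hreg, hcsd, hP⟩ := htower k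
  refine ⟨P, r, hreg, hcsd, fun 𝔭 h𝔭 => ?_⟩
  obtain ⟨hunr, hcomp, α, t, hsat, ht, hbound⟩ := hP 𝔭 h𝔭
  refine ⟨hunr, hcomp, α, hsat, fun 𝔓 h𝔓 τ hτ => ?_⟩
  rw [(hwit 𝔭 (fun h => h𝔭 (hS h))).2.2 𝔓 h𝔓 τ hτ, ← map_sub, ← ht]
  exact hbound

end

end Summit.Langlands.Langlands.Theorems.IrregularClassicality.SlopeFreePolarizedLimit
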